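import Summits.BirchSwinnertonDyer.BirchSwinnertonDyer.Theorems.PrintCFramBottomClassIndexLawFiveLeAnchorReduction
import Summits.BirchSwinnertonDyer.BirchSwinnertonDyer.Theorems.PrintCFramBottomClassIndexLawFiveLeHerbrandBadPlacesInvisible
import Literature.NumberTheory.EllipticCurves.TateModuleGaloisTransportProofs
import Literature.NumberTheory.EllipticCurves.QuadraticBaseChangeGaloisProofs
import Literature.NumberTheory.EllipticCurves.QuadraticTwistSelmerPInfty
import Literature.NumberTheory.EllipticCurves.IrreducibleModPQuadraticTwistProofs
import Literature.NumberTheory.EllipticCurves.GoodReductionUnramifiedProofs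
import Literature.NumberTheory.EllipticCurves.InertiaInvariantsAdditiveProofs
import Literature.NumberTheory.EllipticCurves.TateModuleWildKernelProofs
import Literature.NumberTheory.EllipticCurves.ComplexMultiplicationShaKnappProofs
import Literature.NumberTheory.EllipticCurves.ComplexMultiplicationTwistIsogenyProofs
import Literature.NumberTheory.EllipticCurves.GreenbergSelmer
import Literature.NumberTheory.EllipticCurves.ArchimedeanKummerImageMaximal
import Literature.NumberTheory.GaloisRepresentations.IntegralGaloisActionProofs
import Literature.NumberTheory.GaloisRepresentations.DecompositionGroupOfCompletion
import Literature.NumberTheory.Automorphic.ReciprocityGLnPotentialModularityTateProofs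
import Summits.BirchSwinnertonDyer.BirchSwinnertonDyer.Theorems.QuadraticBranchSignedControlPlusEtaNonsurjUncongruentFineTools
import HarnessLib

/-!
# Route `PrintCFram`, crux C2 `BottomClassIndexLawFiveLe` (stmt-BirchSwinnertonDyer-20372), line `eisenstein-resource-bdp-line`
# (registry v10), Stub H: at a BAD place `v ∤ p` of a CM-ramified class member over ANY number field, SOME INERTIA ELEMENT ACTS
# AS `−1` ON `W_K[p]` — the class-level input of `…HerbrandBadPlacesInvisible` (S-invisibility of the residual Selmer groups)

Cell `bsd-print-cfram`, width seat `bsd-line-cfram-p1-w7` (g0); helper `--supports stmt-BirchSwinnertonDyer-20372`; companion of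
`Theorems/PrintCFramBottomClassIndexLawFiveLeHerbrandBadPlacesInvisible.lean`. THEOREMS ONLY (0 definitions, 0 named facts,
0 instances, no `sorry`). HONEST FRAMING: nothing about BSD is proved; no stub of the line is closed; BSD is not proved by any of
this; no summit statement is proved by this seat.

## What

* §1 (GENERIC, any number field `K`): `E/K` elliptic with GOOD reduction at `v`, `W/K` with `C • W = E^{(d)}` (`d ∈ K^×`), `p` a
  prime with `v ∤ p`. Every inertia element `τ ∈ I_𝔓` (`𝔓 ∣ v`) acts on the `p`-power torsion of `W(K̄)` as the SIGN
  `τ√d/√d = ±1` (`smul_eq_of_inertia_of_twist_of_smul_geomSqrt_eq` / `smul_eq_neg_of_inertia_of_twist_of_smul_geomSqrt_eq_neg`: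
  the tree's sign-equivariant `E^{(d)}(K̄) ≃ E(K̄)`, `exists_addEquiv_geomPoints_quadraticTwist_sign`, and Néron–Ogg–Shafarevich's
  easy direction `smul_eq_of_mem_inertia_of_nsmul_eq_zero`); hence if `W` has BAD reduction at `v` then SOME `σ` in
  GreenbergSelmer's chosen inertia group `inertia v` acts as `−1` on `W[p]`
  (`exists_inertia_smul_eq_neg_of_twist_of_not_hasGoodReductionAt`: otherwise every inertia group above `v` fixes `√d`, `T_p W` is
  unramified at `v` by `galoisRepTate_eq_one_iff_forall_smul_torsion_eq`, and the tree's PROVED criterion of Néron–Ogg–Shafarevich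
  `neronOggShafarevich_holds` makes `v` good; the witness is moved to the chosen prime `𝔓₀ = adicCompletionPrime K v` by the
  transitivity `exists_smul_eq_of_mem_primesAbove_holds`, `I_{g𝔓} = g I_𝔓 g⁻¹`).
* §2 (anchors): an integer model `E₀` with `Δ(E₀) = ±q^k` has good reduction over every number field at every `v ∤ q`
  (`hasGoodReductionAt_baseChange_of_map_int_Δ`, from the tree's `hasGoodReductionAt_baseChange_of_Δ_not_mem`); the seven CM anchors
  `cm7, cm11, cm19, cm43, cm67, cm163` (`Δ = −p³`) and `49a2 = [1,−1,0,−37,−78]` (`Δ = 7³`; `j = 16581375` and ellipticity are the tree's `EtaUncongruentRecords.j_A7b` / `isElliptic_A7b`).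
* §3 ON THE CLASS (`exists_inertia_smul_eq_neg_of_cmRamified`): `W/ℚ` with CM, `CMRamified W p`, `5 ≤ p`, `K` ANY number field,
  `v ∤ p` with `W_K` bad at `v` ⟹ `∃ σ ∈ inertia v, ∀ P ∈ W_K[p], σ • P = −P`. Every member is `ℚ`-isomorphic to a quadratic twist of
  one of the seven anchors (`AnchorReduction.classes_of_cmRamified` + `exists_variableChange_eq_quadraticTwist_intCast_of_j_eq`).

CONSEQUENCE (with the companion file's `datumStrictSelmer_layerZero_eq_empty_of_smul_eq_neg`): in Stub H the set `S` of bad places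
prime to `p` can be ERASED from both residual Selmer groups — M1's class-field-theory modulus is `{w ∣ 𝔭̄}` only.
* §5 (append): the same erasure at EVERY layer `κ.layerSubgroup n` and at the top `κ.kerSubgroup` of any `ℤ_p`-extension (`I_v ≤ ker κ`
  at `v ∤ p`, tree `Iwasawa.inertia_le_kerSubgroup'`): `datumStrictSelmer_{badSet_eq_empty_of_kerSubgroup_le,layer_badSet_eq_empty,kerSubgroup_badSet_eq_empty}_of_cmRamified`.

References: [SilvermanAEC2009] VII.4.1, VII.7.1 (Néron–Ogg–Shafarevich), X.2 Prop. 2.4, X.5 Prop. 5.4 / Cor. 5.4.1;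
[SilvermanATAEC1994] App. A §3; [Cremona1997] Table 1 (49a1–a4, 121b, 361a, 1849a, 4489a, 26569a); [NeukirchANT1999] I §9, II §9.
-/

set_option autoImplicit false
-- the summit namespace `Summit.BirchSwinnertonDyer.BirchSwinnertonDyer` repeats the problem name by design (D-0017)
set_option linter.dupNamespace false

noncomputable section

open scoped Classical Pointwise

namespace Summit.BirchSwinnertonDyer.BirchSwinnertonDyer.Theorems.PrintCFram.BadPlacesSign

open NumberField IsDedekindDomain Field WeierstrassCurve
  Literature.NumberTheory.EllipticCurves Literature.NumberTheory.EllipticCurves.GreenbergSelmer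
  Literature.NumberTheory.EllipticCurves.Rank1Residual
  Literature.NumberTheory.EllipticCurves.GreenbergVatsal2000
  Literature.NumberTheory.GaloisRepresentations
  Summit.BirchSwinnertonDyer.Rank1Residual

/-! ## §1 Generic: inertia acts through signs on the torsion of a quadratic twist of a curve with good reduction -/

section Twist

variable {K : Type} [Field K] [NumberField K] (E W : WeierstrassCurve K)
  {d : K} {C : VariableChange K} {v : HeightOneSpectrum (𝓞 K)} (p : ℕ)

/-- **Inertia fixing `√d` fixes the `p`-power torsion of `W ≅ E^{(d)}`** (`E` good at `v ∤ p`, `τ ∈ I_𝔓`, `𝔓 ∣ v`): transport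
through the `Γ_K`-isomorphism `W(K̄) ≃ E^{(d)}(K̄)` (`twistPointsIso`) and the sign-equivariant `E^{(d)}(K̄) ≃ E(K̄)`
(`exists_addEquiv_geomPoints_quadraticTwist_sign`), then *AEC* VII.4.1 on `E` (`smul_eq_of_mem_inertia_of_nsmul_eq_zero`).
[cite: SilvermanAEC2009, Prop. VII.4.1 and X.5 Cor. 5.4] -/
theorem smul_eq_of_inertia_of_twist_of_smul_geomSqrt_eq [E.IsElliptic] (hd : d ≠ 0) (hC : C • W = E.quadraticTwist d)
    (hv : E.HasGoodReductionAt v) (hpv : ((p : ℕ) : 𝓞 K) ∉ v.asIdeal)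
    {𝔓 : Ideal (absIntegers (𝓞 K) K)} (h𝔓 : 𝔓 ∈ v.primesAbove)
    {τ : absoluteGaloisGroup K} (hτ : τ ∈ 𝔓.inertia (absoluteGaloisGroup K))
    (hsqrt : τ • geomSqrt d = geomSqrt d) {n : ℕ} {P : W.geomPoints} (hP : p ^ n • P = 0) :
    τ • P = P := by
  obtain ⟨f, hfp, -⟩ := E.exists_addEquiv_geomPoints_quadraticTwist_sign hd
  set g := twistPointsIso hC with hg
  have hQ : p ^ n • f (g P) = 0 := by rw [← map_nsmul, ← map_nsmul, hP, map_zero, map_zero]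
  have hfix : τ • f (g P) = f (g P) :=
    E.smul_eq_of_mem_inertia_of_nsmul_eq_zero hv (v.natCast_pow_not_mem hpv n) h𝔓 hτ hQ
  apply g.injective
  apply f.injective
  rw [twistPointsIso_smul, hfp τ hsqrt, hfix]

/-- **Inertia negating `√d` negates the `p`-power torsion of `W ≅ E^{(d)}`** (same hypotheses, `τ√d = −√d`).
[cite: SilvermanAEC2009, Prop. VII.4.1, X.2 Prop. 2.4 and X.5 Cor. 5.4] -/
theorem smul_eq_neg_of_inertia_of_twist_of_smul_geomSqrt_eq_neg [E.IsElliptic] (hd : d ≠ 0) (hC : C • W = E.quadraticTwist d)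
    (hv : E.HasGoodReductionAt v) (hpv : ((p : ℕ) : 𝓞 K) ∉ v.asIdeal)
    {𝔓 : Ideal (absIntegers (𝓞 K) K)} (h𝔓 : 𝔓 ∈ v.primesAbove)
    {τ : absoluteGaloisGroup K} (hτ : τ ∈ 𝔓.inertia (absoluteGaloisGroup K))
    (hsqrt : τ • geomSqrt d = -geomSqrt d) {n : ℕ} {P : W.geomPoints} (hP : p ^ n • P = 0) :
    τ • P = -P := by
  obtain ⟨f, -, hfm⟩ := E.exists_addEquiv_geomPoints_quadraticTwist_sign hd
  set g := twistPointsIso hC with hg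
  have hQ : p ^ n • f (g P) = 0 := by rw [← map_nsmul, ← map_nsmul, hP, map_zero, map_zero]
  have hfix : τ • f (g P) = f (g P) :=
    E.smul_eq_of_mem_inertia_of_nsmul_eq_zero hv (v.natCast_pow_not_mem hpv n) h𝔓 hτ hQ
  apply g.injective
  apply f.injective
  rw [twistPointsIso_smul, hfm τ hsqrt, hfix, map_neg, map_neg]

omit [NumberField K] in
/-- `I_{g • 𝔓} ⊇ g I_𝔓 g⁻¹` (Neukirch I §9 (9.4)). [cite: NeukirchANT1999, Ch. I §9 (9.4)] -/
theorem conj_mem_inertia_smul {𝔓 : Ideal (absIntegers (𝓞 K) K)} {g τ : absoluteGaloisGroup K}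
    (hτ : τ ∈ 𝔓.inertia (absoluteGaloisGroup K)) :
    g * τ * g⁻¹ ∈ (g • 𝔓).inertia (absoluteGaloisGroup K) := by
  intro x
  have hx : τ • g⁻¹ • x - g⁻¹ • x ∈ 𝔓 := hτ (g⁻¹ • x)
  change (g * τ * g⁻¹) • x - x ∈ g • 𝔓
  rw [Ideal.mem_pointwise_smul_iff_inv_smul_mem, smul_sub, mul_smul, mul_smul, inv_smul_smul]
  exact hx

/-- **At a BAD place `v ∤ p` of `W ≅ E^{(d)}` (`E` good at `v`) some element of GreenbergSelmer's inertia group `inertia v` acts as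
`−1` on `W[p]`.** If every inertia element above `v` fixed `√d`, all of them would fix the `p`-power torsion of `W`
(previous lemma), `T_p W` would be unramified at `v` (`galoisRepTate_eq_one_iff_forall_smul_torsion_eq`) and `v` would be good by
the tree's proved criterion of Néron–Ogg–Shafarevich (`neronOggShafarevich_holds`). So some `τ ∈ I_𝔓`, `𝔓 ∣ v`, has `τ√d = −√d`
(`smul_geomSqrt_eq_or`) and acts as `−1`; conjugating `𝔓` to the chosen prime `𝔓₀ = adicCompletionPrime K v`
(`exists_smul_eq_of_mem_primesAbove_holds`, `inertia_adicCompletionPrime_eq_map_absInertia`) moves it into `inertia v`.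
[cite: SilvermanAEC2009, Thm. VII.7.1 and Prop. VII.4.1] [cite: NeukirchANT1999, Ch. I §9 Prop. (9.1)] -/
theorem exists_inertia_smul_eq_neg_of_twist_of_not_hasGoodReductionAt [E.IsElliptic] [W.IsElliptic] [Fact p.Prime] (hd : d ≠ 0) (hC : C • W = E.quadraticTwist d)
    (hv : E.HasGoodReductionAt v) (hpv : ((p : ℕ) : 𝓞 K) ∉ v.asIdeal) (hbad : ¬ W.HasGoodReductionAt v) :
    ∃ σ ∈ inertia (K := K) v, ∀ P : W.geomTorsion (p : ℤ), σ • P = -P := by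
  -- some inertia element above `v` negates `√d`
  have hex : ∃ 𝔓 ∈ v.primesAbove, ∃ τ ∈ 𝔓.inertia (absoluteGaloisGroup K), τ • geomSqrt d = -geomSqrt d := by
    by_contra h
    push Not at h
    apply hbad
    refine W.neronOggShafarevich_holds v p hpv fun 𝔓 h𝔓 τ hτ ↦ ?_
    rw [galoisRepTate_eq_one_iff_forall_smul_torsion_eq]
    intro n P hP
    have hsqrt : τ • geomSqrt d = geomSqrt d :=
      (smul_geomSqrt_eq_or τ d).resolve_right (h 𝔓 h𝔓 τ hτ)
    exact smul_eq_of_inertia_of_twist_of_smul_geomSqrt_eq E W p hd hC hv hpv h𝔓 hτ hsqrt hP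
  obtain ⟨𝔓, h𝔓, τ, hτ, hsqrt⟩ := hex
  have hneg : ∀ P : W.geomTorsion (p : ℤ), τ • P = -P := fun P ↦ Subtype.ext (by
    rw [AddSubgroup.torsionBy.coe_smul, AddSubgroup.coe_neg]
    refine smul_eq_neg_of_inertia_of_twist_of_smul_geomSqrt_eq_neg E W p hd hC hv hpv h𝔓 hτ hsqrt (n := 1) ?_
    have h := congrArg ((↑) : W.geomTorsion (p : ℤ) → W.geomPoints) (W.natAbs_nsmul_geomTorsion P)
    rw [AddSubmonoidClass.coe_nsmul, ZeroMemClass.coe_zero, Int.natAbs_natCast] at h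
    rw [pow_one]
    exact h)
  -- move to the chosen prime above `v`
  obtain ⟨g, hg⟩ := HeightOneSpectrum.exists_smul_eq_of_mem_primesAbove_holds (K := K) (v := v) h𝔓
    (adicCompletionPrime_mem_primesAbove K v)
  refine ⟨g * τ * g⁻¹, ?_, fun P ↦ ?_⟩
  · have e : inertia (K := K) v = (adicCompletionPrime K v).inertia (absoluteGaloisGroup K) :=
      (inertia_adicCompletionPrime_eq_map_absInertia K v).symm
    rw [e, ← hg]
    exact conj_mem_inertia_smul hτ
  · rw [mul_smul, mul_smul, hneg, smul_neg, smul_inv_smul]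

end Twist

/-! ## §2 Anchors: integer models with prime-power discriminant have good reduction off that prime over every number field -/

section Anchors

variable (K : Type) [Field K] [NumberField K]

/-- **An integer model with `Δ = ±q^k` has good reduction at every `v ∤ q` over every number field** (its base change is an
integral model with `v`-unit discriminant: the tree's `hasGoodReductionAt_baseChange_of_Δ_not_mem`, *AEC* Rem. VII.1.1 + VII.5.1(a)).
[cite: SilvermanAEC2009, Rem. VII.1.1 and Prop. VII.5.1(a)] -/
theorem hasGoodReductionAt_baseChange_of_map_int_Δ (E₀ : WeierstrassCurve ℤ) {q : ℕ} {u : ℤˣ} {k : ℕ}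
    (hΔ : E₀.Δ = (u : ℤ) * (q : ℤ) ^ k) {v : HeightOneSpectrum (𝓞 K)} (hqv : ((q : ℕ) : 𝓞 K) ∉ v.asIdeal) :
    ((E₀.map (Int.castRingHom ℚ)).baseChange K).HasGoodReductionAt v := by
  have e : (E₀.map (Int.castRingHom ℚ)).baseChange K = (E₀.map (Int.castRingHom (𝓞 K))).baseChange K := by
    rw [baseChange, baseChange, map_map, map_map]
    congr 1
    exact RingHom.ext_int _ _
  rw [e]
  apply Literature.NumberTheory.Automorphic.hasGoodReductionAt_baseChange_of_Δ_not_mem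
  rw [map_Δ, hΔ, map_mul, map_pow, map_natCast]
  intro hmem
  rcases v.isPrime.mem_or_mem hmem with hu | hk
  · exact v.isPrime.ne_top (Ideal.eq_top_of_isUnit_mem _ hu ((Units.isUnit u).map _))
  · exact hqv (v.isPrime.mem_of_pow_mem k hk)

/-- The six Gross curves `A(p)` as integer models mapped to `ℚ` (the tree's `cm7 … cm163`). [cite: SilvermanATAEC1994, App. A §3] -/
theorem cm_eq_map_int :
    cm7 = (⟨1, -1, 0, -2, -1⟩ : WeierstrassCurve ℤ).map (Int.castRingHom ℚ) ∧
    cm11 = (⟨0, -1, 1, -7, 10⟩ : WeierstrassCurve ℤ).map (Int.castRingHom ℚ) ∧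
    cm19 = (⟨0, 0, 1, -38, 90⟩ : WeierstrassCurve ℤ).map (Int.castRingHom ℚ) ∧
    cm43 = (⟨0, 0, 1, -860, 9707⟩ : WeierstrassCurve ℤ).map (Int.castRingHom ℚ) ∧
    cm67 = (⟨0, 0, 1, -7370, 243528⟩ : WeierstrassCurve ℤ).map (Int.castRingHom ℚ) ∧
    cm163 = (⟨0, 0, 1, -2174420, 1234136692⟩ : WeierstrassCurve ℤ).map (Int.castRingHom ℚ) := by
  refine ⟨?_, ?_, ?_, ?_, ?_, ?_⟩ <;> ext <;> simp [WeierstrassCurve.map]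

/-- Discriminants of the integer models: `Δ(A(p)) = −p³` and `Δ(49a2) = 7³`. [cite: Cremona1997, Table 1] -/
theorem Δ_int_models :
    (⟨1, -1, 0, -2, -1⟩ : WeierstrassCurve ℤ).Δ = ((-1 : ℤˣ) : ℤ) * (7 : ℕ) ^ 3 ∧
    (⟨0, -1, 1, -7, 10⟩ : WeierstrassCurve ℤ).Δ = ((-1 : ℤˣ) : ℤ) * (11 : ℕ) ^ 3 ∧
    (⟨0, 0, 1, -38, 90⟩ : WeierstrassCurve ℤ).Δ = ((-1 : ℤˣ) : ℤ) * (19 : ℕ) ^ 3 ∧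
    (⟨0, 0, 1, -860, 9707⟩ : WeierstrassCurve ℤ).Δ = ((-1 : ℤˣ) : ℤ) * (43 : ℕ) ^ 3 ∧
    (⟨0, 0, 1, -7370, 243528⟩ : WeierstrassCurve ℤ).Δ = ((-1 : ℤˣ) : ℤ) * (67 : ℕ) ^ 3 ∧
    (⟨0, 0, 1, -2174420, 1234136692⟩ : WeierstrassCurve ℤ).Δ = ((-1 : ℤˣ) : ℤ) * (163 : ℕ) ^ 3 ∧
    (⟨1, -1, 0, -37, -78⟩ : WeierstrassCurve ℤ).Δ = ((1 : ℤˣ) : ℤ) * (7 : ℕ) ^ 3 := by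
  refine ⟨?_, ?_, ?_, ?_, ?_, ?_, ?_⟩ <;>
    norm_num [WeierstrassCurve.Δ, WeierstrassCurve.b₂, WeierstrassCurve.b₄, WeierstrassCurve.b₆, WeierstrassCurve.b₈]

/-- `49a2` over `ℚ` is the integer model mapped to `ℚ`. [folklore] -/
theorem curve49a2_eq_map_int :
    (⟨1, -1, 0, -37, -78⟩ : WeierstrassCurve ℚ) = (⟨1, -1, 0, -37, -78⟩ : WeierstrassCurve ℤ).map (Int.castRingHom ℚ) := by
  ext <;> simp [WeierstrassCurve.map]

end Anchors

/-! ## §3 On the CM-ramified class: some inertia element acts as `−1` on `W_K[p]` at every bad `v ∤ p` -/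

section Class

variable {K : Type} [Field K] [NumberField K] {p : ℕ} [Fact p.Prime]

/-- **From an anchor with good reduction.** If `j(W) = j(E) ∉ {0, 1728}` for an elliptic `E/ℚ` whose base change to `K` has good
reduction at `v ∤ p`, and `W_K` is bad at `v`, then some `σ ∈ inertia v` acts as `−1` on `W_K[p]`: `C • W = E^{(d)}` over `ℚ`
(`exists_variableChange_eq_quadraticTwist_intCast_of_j_eq`), base-changed to `K` (`VariableChange.baseChange_smul_eq`,
`baseChange_quadraticTwist`), then §1. [cite: SilvermanAEC2009, X.5 Cor. 5.4.1 and Thm. VII.7.1] -/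
theorem exists_inertia_smul_eq_neg_of_j_eq (W E : WeierstrassCurve ℚ) [W.IsElliptic] [E.IsElliptic]
    (hj : W.j = E.j) (h0 : E.j ≠ 0) (h1728 : E.j ≠ 1728) {v : HeightOneSpectrum (𝓞 K)}
    (hpv : ((p : ℕ) : 𝓞 K) ∉ v.asIdeal) (hE : (E.baseChange K).HasGoodReductionAt v)
    (hbad : ¬ (W.baseChange K).HasGoodReductionAt v) :
    ∃ σ ∈ inertia (K := K) v, ∀ P : (W.baseChange K).geomTorsion (p : ℤ), σ • P = -P := by
  obtain ⟨d, hd0, -, C, hC⟩ := exists_variableChange_eq_quadraticTwist_intCast_of_j_eq hj h0 h1728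
  have hCK : C.map (algebraMap ℚ K) • W.baseChange K = (E.baseChange K).quadraticTwist (algebraMap ℚ K (d : ℚ)) := by
    rw [← VariableChange.baseChange_smul_eq, hC, baseChange_quadraticTwist]
  have hdK : algebraMap ℚ K (d : ℚ) ≠ 0 := by
    rw [map_intCast]; exact Int.cast_ne_zero.mpr hd0
  exact exists_inertia_smul_eq_neg_of_twist_of_not_hasGoodReductionAt (E.baseChange K) (W.baseChange K) p hdK hCK hE hpv hbad

/-- **ON THE CLASS.** For `W/ℚ` elliptic with CM and a prime `p ≥ 5` ramified in the CM field (`CMRamified W p`; the seven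
`(p, j)` classes of `AnchorReduction.classes_of_cmRamified`), ANY number field `K` and any finite place `v ∤ p` of `K` at which
`W_K` has BAD reduction: **some `σ` in GreenbergSelmer's inertia group `inertia v` acts as `−1` on `W_K[p]`.** Each class is
anchored at an integer model with discriminant `±p³` (`cm7, …, cm163`, and `49a2` for `j = 16581375`), good at `v` over `K` by §2.
[cite: SilvermanATAEC1994, App. A §3] [cite: Cremona1997, Table 1] [cite: SilvermanAEC2009, X.5 Cor. 5.4.1 and Thm. VII.7.1] -/
theorem exists_inertia_smul_eq_neg_of_cmRamified (W : WeierstrassCurve ℚ) [W.IsElliptic]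
    (hCM : W.HasCM) (hram : CMRamified W p) (h5 : 5 ≤ p) {v : HeightOneSpectrum (𝓞 K)}
    (hpv : ((p : ℕ) : 𝓞 K) ∉ v.asIdeal) (hbad : ¬ (W.baseChange K).HasGoodReductionAt v) :
    ∃ σ ∈ inertia (K := K) v, ∀ P : (W.baseChange K).geomTorsion (p : ℤ), σ • P = -P := by
  have hp : p.Prime := Fact.out
  obtain ⟨e7, e11, e19, e43, e67, e163⟩ := cm_eq_map_int
  obtain ⟨d7, d11, d19, d43, d67, d163, d49⟩ := Δ_int_models
  rcases AnchorReduction.classes_of_cmRamified W hp hCM hram h5 with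
    ⟨rfl, hj | hj⟩ | ⟨rfl, hj⟩ | ⟨rfl, hj⟩ | ⟨rfl, hj⟩ | ⟨rfl, hj⟩ | ⟨rfl, hj⟩
  · -- `(7, −3375)`: anchor `cm7 = 49a1`
    refine exists_inertia_smul_eq_neg_of_j_eq W cm7 (by rw [hj, j_cm7]) (by rw [j_cm7]; norm_num)
      (by rw [j_cm7]; norm_num) hpv ?_ hbad
    rw [e7]; exact hasGoodReductionAt_baseChange_of_map_int_Δ K _ d7 hpv
  · -- `(7, 16581375)`: anchor `49a2`
    haveI := EtaUncongruentRecords.isElliptic_A7b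
    refine exists_inertia_smul_eq_neg_of_j_eq W (⟨1, -1, 0, -37, -78⟩ : WeierstrassCurve ℚ)
      (by rw [hj, EtaUncongruentRecords.j_A7b]) (by rw [EtaUncongruentRecords.j_A7b]; norm_num)
      (by rw [EtaUncongruentRecords.j_A7b]; norm_num) hpv ?_ hbad
    rw [curve49a2_eq_map_int]; exact hasGoodReductionAt_baseChange_of_map_int_Δ K _ d49 hpv
  · -- `(11, −32768)`
    refine exists_inertia_smul_eq_neg_of_j_eq W cm11 (by rw [hj, j_cm11]) (by rw [j_cm11]; norm_num)
      (by rw [j_cm11]; norm_num) hpv ?_ hbad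
    rw [e11]; exact hasGoodReductionAt_baseChange_of_map_int_Δ K _ d11 hpv
  · -- `(19, −884736)`
    refine exists_inertia_smul_eq_neg_of_j_eq W cm19 (by rw [hj, j_cm19]) (by rw [j_cm19]; norm_num)
      (by rw [j_cm19]; norm_num) hpv ?_ hbad
    rw [e19]; exact hasGoodReductionAt_baseChange_of_map_int_Δ K _ d19 hpv
  · -- `(43, −884736000)`
    refine exists_inertia_smul_eq_neg_of_j_eq W cm43 (by rw [hj, j_cm43]) (by rw [j_cm43]; norm_num)
      (by rw [j_cm43]; norm_num) hpv ?_ hbad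
    rw [e43]; exact hasGoodReductionAt_baseChange_of_map_int_Δ K _ d43 hpv
  · -- `(67, −147197952000)`
    refine exists_inertia_smul_eq_neg_of_j_eq W cm67 (by rw [hj, j_cm67]) (by rw [j_cm67]; norm_num)
      (by rw [j_cm67]; norm_num) hpv ?_ hbad
    rw [e67]; exact hasGoodReductionAt_baseChange_of_map_int_Δ K _ d67 hpv
  · -- `(163, −262537412640768000)`
    refine exists_inertia_smul_eq_neg_of_j_eq W cm163 (by rw [hj, j_cm163]) (by rw [j_cm163]; norm_num)
      (by rw [j_cm163]; norm_num) hpv ?_ hbad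
    rw [e163]; exact hasGoodReductionAt_baseChange_of_map_int_Δ K _ d163 hpv

end Class

/-! ## §4 Stub H's set `S` erased on the class (with `…HerbrandBadPlacesInvisible`) -/

section StubH

variable {K : Type} [Field K] [NumberField K] {p : ℕ} [Fact p.Prime]

/-- **S-ERASURE ON THE CM-RAMIFIED CLASS, in Stub H's exact shape.** For `W/ℚ` elliptic with CM, `p ≥ 5` CM-ramified, ANY number
field `K` (Stub H: the Heegner field `K''`), ANY `ℤ_p`-extension `κ`, ANY `Γ_K`-stable subgroup `Φ ≤ W_K[p]` and ANY Greenberg data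
`L`, `L'` at `p` (Stub H: `AcSelmer.bdpData _ p 𝔭`): with `S = {v : W_K bad at v ∧ v ∤ p}` as displayed in
`stub_bottomResidualSelmer_trivial_of_bernoulliPair`, BOTH bottom-layer residual Selmer groups satisfy
`R^S(K, Φ) = R^∅(K, Φ)` and `R^S(K, W_K[p]/Φ) = R^∅(K, W_K[p]/Φ)` — the bad places prime to `p` impose nothing and may be treated
as UNRAMIFIED places. (§3 + `BadPlacesInvisible.datumStrictSelmer_layerZero_eq_empty_of_smul_eq_neg`.)
[cite: GreenbergVatsal2000, §2 pp. 15–17, 20, 23] [cite: SilvermanAEC2009, Thm. VII.7.1 and X.5 Cor. 5.4.1] [cite: MilneADT2006, I §2 Lemma 2.9] -/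
theorem datumStrictSelmer_layerZero_badSet_eq_empty_of_cmRamified (W : WeierstrassCurve ℚ) [W.IsElliptic]
    (hCM : W.HasCM) (hram : CMRamified W p) (h5 : 5 ≤ p) (κ : ZpExtension K p)
    (Φ : X2.ResidualDevissageModules.StableSubgroup (absoluteGaloisGroup K) ((W.baseChange K).geomTorsion (p : ℤ)))
    (L : Data K Φ.Sub p) (L' : Data K Φ.Quot p) :
    datumStrictSelmer (κ.layerSubgroup 0) Φ.Sub p L
        {v : HeightOneSpectrum (𝓞 K) | ¬ (W.baseChange K).HasGoodReductionAt v ∧ ((p : ℕ) : 𝓞 K) ∉ v.asIdeal} =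
      datumStrictSelmer (κ.layerSubgroup 0) Φ.Sub p L ∅ ∧
    datumStrictSelmer (κ.layerSubgroup 0) Φ.Quot p L'
        {v : HeightOneSpectrum (𝓞 K) | ¬ (W.baseChange K).HasGoodReductionAt v ∧ ((p : ℕ) : 𝓞 K) ∉ v.asIdeal} =
      datumStrictSelmer (κ.layerSubgroup 0) Φ.Quot p L' ∅ :=
  BadPlacesInvisible.datumStrictSelmer_layerZero_eq_empty_of_smul_eq_neg (W.baseChange K) κ Φ (by omega) L L' _
    fun _ hv hpv ↦ exists_inertia_smul_eq_neg_of_cmRamified W hCM hram h5 hpv hv.1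

end StubH

/-! ## §5 (append, w7 g0) The same erasure at EVERY layer of a `ℤ_p`-extension and at its top -/

section Tower

variable {K : Type} [Field K] [NumberField K] {p : ℕ} [Fact p.Prime]

/-- **S-erasure at every layer `K_n` and at the top `K_∞` of ANY `ℤ_p`-extension.** For `W/ℚ` elliptic with CM, `p ≥ 5` CM-ramified, ANY
number field `K`, any `κ : ZpExtension K p`, any `Γ_K`-stable `Φ ≤ W_K[p]`, all Greenberg data `L`, `L'`, and the bad set
`S = {v : ¬ W_K good at v ∧ v ∤ p}`: for every subgroup `H` with `ker κ ≤ H` (the layers `κ.layerSubgroup n` and `κ.kerSubgroup` itself —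
`ℤ_p`-extensions are unramified outside `p`, so `I_v ≤ ker κ ≤ H` at `v ∤ p`, tree `Iwasawa.inertia_le_kerSubgroup'`), the groups with «no
condition at `S`» and with «no condition nowhere» coincide, for `Φ.Sub` and for `Φ.Quot`. So the set `S` is invisible along the whole
anticyclotomic (or any) tower, not only at the bottom layer used by Stub H.
[cite: GreenbergVatsal2000, §2 pp. 15–17, 20, 23] [cite: Washington1997, Prop. 13.2] [cite: MilneADT2006, I §2 Lemma 2.9] -/
theorem datumStrictSelmer_badSet_eq_empty_of_kerSubgroup_le_of_cmRamified (W : WeierstrassCurve ℚ) [W.IsElliptic]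
    (hCM : W.HasCM) (hram : CMRamified W p) (h5 : 5 ≤ p) (κ : ZpExtension K p)
    (H : Subgroup (absoluteGaloisGroup K)) [H.Normal] (hH : κ.kerSubgroup ≤ H)
    (Φ : X2.ResidualDevissageModules.StableSubgroup (absoluteGaloisGroup K) ((W.baseChange K).geomTorsion (p : ℤ)))
    (L : Data K Φ.Sub p) (L' : Data K Φ.Quot p) :
    datumStrictSelmer H Φ.Sub p L
        {v : HeightOneSpectrum (𝓞 K) | ¬ (W.baseChange K).HasGoodReductionAt v ∧ ((p : ℕ) : 𝓞 K) ∉ v.asIdeal} =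
      datumStrictSelmer H Φ.Sub p L ∅ ∧
    datumStrictSelmer H Φ.Quot p L'
        {v : HeightOneSpectrum (𝓞 K) | ¬ (W.baseChange K).HasGoodReductionAt v ∧ ((p : ℕ) : 𝓞 K) ∉ v.asIdeal} =
      datumStrictSelmer H Φ.Quot p L' ∅ := by
  have hp2 : p ≠ 2 := by omega
  have hcont := CumulativeHeegnerInclusionAtThreeResidualDevissage.continuous_smul_geomTorsion (W.baseChange K) (p : ℤ)
  have hI : ∀ v : HeightOneSpectrum (𝓞 K), ((p : ℕ) : 𝓞 K) ∉ v.asIdeal → inertia (K := K) v ≤ H := fun v hpv ↦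
    (Iwasawa.inertia_le_kerSubgroup' κ v hpv).trans hH
  obtain ⟨hfinS, hcardS⟩ := BadPlacesInvisible.finite_sub_and_exists_natCard_eq_pow (W.baseChange K) Φ
  obtain ⟨hfinQ, hcardQ⟩ := BadPlacesInvisible.finite_quot_and_exists_natCard_eq_pow (W.baseChange K) Φ
  haveI := hfinS
  haveI := hfinQ
  refine ⟨BadPlacesInvisible.datumStrictSelmer_eq_of_noFixed L (Set.empty_subset _) hcardS (Φ.continuous_smul_sub hcont)
      (fun v _ _ hpv ↦ hI v hpv) fun v hv _ hpv x hx ↦ ?_,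
    BadPlacesInvisible.datumStrictSelmer_eq_of_noFixed L' (Set.empty_subset _) hcardQ (Φ.continuous_smul_quot hcont)
      (fun v _ _ hpv ↦ hI v hpv) fun v hv _ hpv y hy ↦ ?_⟩
  · obtain ⟨σ, hσI, hσ⟩ := exists_inertia_smul_eq_neg_of_cmRamified W hCM hram h5 hpv hv.1
    exact BadPlacesInvisible.noFixed_sub_of_smul_eq_neg (W.baseChange K) Φ hp2 hσ x (hx σ hσI)
  · obtain ⟨σ, hσI, hσ⟩ := exists_inertia_smul_eq_neg_of_cmRamified W hCM hram h5 hpv hv.1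
    exact BadPlacesInvisible.noFixed_quot_of_smul_eq_neg (W.baseChange K) Φ hp2 hσ y (hy σ hσI)

/-- The layers: `R^S(K_n, ·) = R^∅(K_n, ·)` for every `n` (`H = κ.layerSubgroup n ⊇ ker κ`). [cite: GreenbergVatsal2000, §2 pp. 15–17, 20, 23] -/
theorem datumStrictSelmer_layer_badSet_eq_empty_of_cmRamified (W : WeierstrassCurve ℚ) [W.IsElliptic]
    (hCM : W.HasCM) (hram : CMRamified W p) (h5 : 5 ≤ p) (κ : ZpExtension K p) (n : ℕ)
    (Φ : X2.ResidualDevissageModules.StableSubgroup (absoluteGaloisGroup K) ((W.baseChange K).geomTorsion (p : ℤ)))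
    (L : Data K Φ.Sub p) (L' : Data K Φ.Quot p) :
    datumStrictSelmer (κ.layerSubgroup n) Φ.Sub p L
        {v : HeightOneSpectrum (𝓞 K) | ¬ (W.baseChange K).HasGoodReductionAt v ∧ ((p : ℕ) : 𝓞 K) ∉ v.asIdeal} =
      datumStrictSelmer (κ.layerSubgroup n) Φ.Sub p L ∅ ∧
    datumStrictSelmer (κ.layerSubgroup n) Φ.Quot p L'
        {v : HeightOneSpectrum (𝓞 K) | ¬ (W.baseChange K).HasGoodReductionAt v ∧ ((p : ℕ) : 𝓞 K) ∉ v.asIdeal} =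
      datumStrictSelmer (κ.layerSubgroup n) Φ.Quot p L' ∅ :=
  datumStrictSelmer_badSet_eq_empty_of_kerSubgroup_le_of_cmRamified W hCM hram h5 κ (κ.layerSubgroup n)
    (ZpExtension.kerSubgroup_le_layerSubgroup κ n) Φ L L'

/-- The top: `R^S(K_∞, ·) = R^∅(K_∞, ·)` (`H = κ.kerSubgroup`). [cite: GreenbergVatsal2000, §2 pp. 15–17, 20, 23] -/
theorem datumStrictSelmer_kerSubgroup_badSet_eq_empty_of_cmRamified (W : WeierstrassCurve ℚ) [W.IsElliptic]
    (hCM : W.HasCM) (hram : CMRamified W p) (h5 : 5 ≤ p) (κ : ZpExtension K p)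
    (Φ : X2.ResidualDevissageModules.StableSubgroup (absoluteGaloisGroup K) ((W.baseChange K).geomTorsion (p : ℤ)))
    (L : Data K Φ.Sub p) (L' : Data K Φ.Quot p) :
    datumStrictSelmer κ.kerSubgroup Φ.Sub p L
        {v : HeightOneSpectrum (𝓞 K) | ¬ (W.baseChange K).HasGoodReductionAt v ∧ ((p : ℕ) : 𝓞 K) ∉ v.asIdeal} =
      datumStrictSelmer κ.kerSubgroup Φ.Sub p L ∅ ∧
    datumStrictSelmer κ.kerSubgroup Φ.Quot p L'
        {v : HeightOneSpectrum (𝓞 K) | ¬ (W.baseChange K).HasGoodReductionAt v ∧ ((p : ℕ) : 𝓞 K) ∉ v.asIdeal} =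
      datumStrictSelmer κ.kerSubgroup Φ.Quot p L' ∅ :=
  datumStrictSelmer_badSet_eq_empty_of_kerSubgroup_le_of_cmRamified W hCM hram h5 κ κ.kerSubgroup le_rfl Φ L L'

end Tower




end Summit.BirchSwinnertonDyer.BirchSwinnertonDyer.Theorems.PrintCFram.BadPlacesSign

end
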